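import Mathlib

/-!
# Route `FilamentSkeletonRss` · crux `SkeletonJ1R` (stmt-NavierStokesRegularity-23610) · registered line `streamline_kantorovich_R`
# — brick K-§3a (tools) for stub K `KantorovichClosingL`: the Euler kernel `x^{K} = exp(log x · K)` of a bounded operator and
# integrands continuous on `(0, b]`

Hand `ns-filament-21221-p1` (g18), `--supports stmt-NavierStokesRegularity-23610 --as helper`; pure Mathlib, route-independent.

WHY.  Tool lemmas for `…SkeletonJ1RSingularBranch.lean` (the nonlinear regular branch at a singularity of the first kind — Levinson's
integral equation from the singular end, used to build the 1-D unstable curve of the switched field at a waist zero by the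
parameterization method, K-notes §3 of the lead): (§1) the operator exponential `exp(aK)` of a bounded operator `K` on a real Banach
space — group law `exp(aK)exp(bK) = exp((a+b)K)`, the Euler kernel `x ↦ exp(log x · K)` and its derivative `x⁻¹ K exp(log x · K)`,
continuity, and the kernel bounds `‖exp(−log s·K₀)Πw‖, ‖exp(log y·K₀)exp(−log s·K₀)Πw‖ ≤ C‖Π‖‖w‖` (`0 < s ≤ y`, `s ≤ 1`) from a
bounded forward semigroup `‖exp(tK₀)Πv‖ ≤ C‖Πv‖`; (§2) interval-integrability of functions continuous on `(a, b]` and bounded, the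
norm bound `‖∫₀ʸ φ‖ ≤ B y`, continuity at `0⁺` from a linear bound, and closedness of the set of `B̄(ξ, R)`-valued bounded continuous
functions (the complete metric space of the contraction).

HONEST FRAMING.  Calculus bookkeeping for a sub-brick of an OPEN stub (K) of the ∃-side of a HYPOTHETICAL filament-type rotating-self-similar
blow-up skeleton (MODEL rung, negative side); nothing here is a claim about Navier–Stokes regularity or blow-up; stub K and the crux stay OPEN.
-/

set_option linter.dupNamespace false -- `NavierStokesRegularity.NavierStokesRegularity` path/namespace repetition is the tree convention

noncomputable section

namespace Summit.NavierStokesRegularity.NavierStokesRegularity.Theorems.SkeletonJ1RUnstableCurve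

open Set Function Filter MeasureTheory intervalIntegral Metric NormedSpace
open scoped Topology BoundedContinuousFunction NNReal

variable {E : Type*} [NormedAddCommGroup E] [NormedSpace ℝ E] [CompleteSpace E]


/-! ## §1 The Euler kernel `x^{K} = exp(log x · K)` in the operator algebra -/

/-- `exp(aK) exp(bK) = exp((a+b)K)` for a bounded operator `K` (commuting exponents). [folklore] -/
theorem exp_smul_mul_exp_smul (K : E →L[ℝ] E) (a b : ℝ) :
    exp (a • K) * exp (b • K) = exp ((a + b) • K) := by
  letI : NormedAlgebra ℚ (E →L[ℝ] E) := NormedAlgebra.restrictScalars ℚ ℝ (E →L[ℝ] E)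
  have hc : Commute (a • K) (b • K) := ((Commute.refl K).smul_left a).smul_right b
  rw [add_smul, exp_add_of_commute hc]

/-- `exp(aK) (exp(bK) v) = exp((a+b)K) v`. [folklore] -/
theorem exp_smul_apply_exp_smul (K : E →L[ℝ] E) (a b : ℝ) (v : E) :
    exp (a • K) (exp (b • K) v) = exp ((a + b) • K) v := by
  rw [← exp_smul_mul_exp_smul K a b]; rfl

/-- `exp(aK) (exp(−aK) v) = v`. [folklore] -/
theorem exp_smul_apply_exp_neg_smul (K : E →L[ℝ] E) (a : ℝ) (v : E) :
    exp (a • K) (exp ((-a) • K) v) = v := by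
  rw [exp_smul_apply_exp_smul, add_neg_cancel, zero_smul, exp_zero]; rfl

/-- The Euler kernel `x ↦ x^{K} = exp(log x · K)` is differentiable on `x > 0` with derivative `x⁻¹ K x^{K}`. [folklore] -/
theorem hasDerivAt_exp_log_smul (K : E →L[ℝ] E) {x : ℝ} (hx : 0 < x) :
    HasDerivAt (fun y : ℝ => exp (Real.log y • K)) (x⁻¹ • (K * exp (Real.log x • K))) x := by
  have h1 : HasDerivAt (fun t : ℝ => exp (t • K)) (K * exp (Real.log x • K)) (Real.log x) :=
    hasDerivAt_exp_smul_const' (𝕂 := ℝ) K (Real.log x)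
  exact h1.scomp x (Real.hasDerivAt_log hx.ne')

/-- `t ↦ exp(tK)` is continuous (it is differentiable). [folklore] -/
theorem continuous_exp_smul (K : E →L[ℝ] E) : Continuous fun t : ℝ => exp (t • K) :=
  continuous_iff_continuousAt.2 fun t => (hasDerivAt_exp_smul_const (𝕂 := ℝ) K t).continuousAt

/-- `y ↦ exp(−log y · K)` is continuous on `(0, ∞)`. [folklore] -/
theorem continuousOn_exp_neg_log_smul (K : E →L[ℝ] E) :
    ContinuousOn (fun y : ℝ => exp ((-Real.log y) • K)) (Ioi 0) := by
  have hlog : ContinuousOn (fun y : ℝ => -Real.log y) (Ioi 0) :=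
    (Real.continuousOn_log.mono fun y hy => ne_of_gt (mem_Ioi.1 hy)).neg
  exact (continuous_exp_smul K).comp_continuousOn hlog

/-- `y ↦ exp(log y · K)` is continuous on `(0, ∞)`. [folklore] -/
theorem continuousOn_exp_log_smul (K : E →L[ℝ] E) :
    ContinuousOn (fun y : ℝ => exp (Real.log y • K)) (Ioi 0) := by
  have hlog : ContinuousOn (fun y : ℝ => Real.log y) (Ioi 0) :=
    Real.continuousOn_log.mono fun y hy => ne_of_gt (mem_Ioi.1 hy)
  exact (continuous_exp_smul K).comp_continuousOn hlog

/-! ## §2 Integrands that are continuous on `(0, b]` and bounded -/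

omit [NormedSpace ℝ E] [CompleteSpace E] in
/-- A function continuous on `(a, b]` and bounded there is interval-integrable on `[a, b]`. [folklore] -/
theorem intervalIntegrable_of_continuousOn_Ioc {φ : ℝ → E} {a b B : ℝ} (hab : a ≤ b)
    (hφ : ContinuousOn φ (Ioc a b)) (hB : ∀ s ∈ Ioc a b, ‖φ s‖ ≤ B) :
    IntervalIntegrable φ volume a b := by
  rw [intervalIntegrable_iff_integrableOn_Ioc_of_le hab]
  have hg : IntegrableOn (fun _ : ℝ => B) (Ioc a b) volume := integrableOn_const measure_Ioc_lt_top.ne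
  exact Integrable.mono' hg (hφ.aestronglyMeasurable measurableSet_Ioc)
    ((ae_restrict_mem measurableSet_Ioc).mono fun s hs => hB s hs)

omit [CompleteSpace E] in
/-- Norm of `∫₀ʸ φ` for `φ` bounded by `B` on `(0, y]`. [folklore] -/
theorem norm_integral_le_of_le_on_Ioc {φ : ℝ → E} {y B : ℝ} (hy : 0 ≤ y)
    (hB : ∀ s ∈ Ioc 0 y, ‖φ s‖ ≤ B) : ‖∫ s in (0 : ℝ)..y, φ s‖ ≤ B * y := by
  have h := intervalIntegral.norm_integral_le_of_norm_le_const (a := 0) (b := y) (f := φ) (C := B)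
    (fun s hs => hB s (by rwa [uIoc_of_le hy] at hs))
  rwa [sub_zero, abs_of_nonneg hy] at h

omit [CompleteSpace E] in
/-- Kernel bound at the singular end: if `‖exp(tK₀)(Π v)‖ ≤ C‖Π v‖` for `t ≥ 0`, then for `0 < s ≤ 1`,
`‖exp(−log s · K₀)(Π w)‖ ≤ C‖Π‖‖w‖`. [folklore] -/
theorem norm_exp_neg_log_smul_apply_le {K₀ Pr : E →L[ℝ] E} {C : ℝ} (hC : 0 ≤ C)
    (hbound : ∀ t : ℝ, 0 ≤ t → ∀ v : E, ‖exp (t • K₀) (Pr v)‖ ≤ C * ‖Pr v‖)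
    {s : ℝ} (hs : 0 < s) (hs1 : s ≤ 1) (w : E) :
    ‖exp ((-Real.log s) • K₀) (Pr w)‖ ≤ C * ‖Pr‖ * ‖w‖ := by
  have ht : 0 ≤ -Real.log s := by have := Real.log_nonpos hs.le hs1; linarith
  calc ‖exp ((-Real.log s) • K₀) (Pr w)‖ ≤ C * ‖Pr w‖ := hbound _ ht w
    _ ≤ C * (‖Pr‖ * ‖w‖) := mul_le_mul_of_nonneg_left (Pr.le_opNorm w) hC
    _ = C * ‖Pr‖ * ‖w‖ := by ring

/-- The composite Euler kernel `exp(log y · K₀) exp(−log s · K₀) Π = exp((log y − log s) K₀) Π` is bounded by `C‖Π‖` for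
`0 < s ≤ y` when the forward semigroup is bounded by `C` on the range of `Π`. [folklore] -/
theorem norm_exp_log_smul_apply_apply_le {K₀ Pr : E →L[ℝ] E} {C : ℝ} (hC : 0 ≤ C)
    (hbound : ∀ t : ℝ, 0 ≤ t → ∀ v : E, ‖exp (t • K₀) (Pr v)‖ ≤ C * ‖Pr v‖)
    {s y : ℝ} (hs : 0 < s) (hsy : s ≤ y) (w : E) :
    ‖exp (Real.log y • K₀) (exp ((-Real.log s) • K₀) (Pr w))‖ ≤ C * ‖Pr‖ * ‖w‖ := by
  have ht : 0 ≤ Real.log y + -Real.log s := by have := Real.log_le_log hs hsy; linarith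
  rw [exp_smul_apply_exp_smul]
  calc ‖exp ((Real.log y + -Real.log s) • K₀) (Pr w)‖ ≤ C * ‖Pr w‖ := hbound _ ht w
    _ ≤ C * (‖Pr‖ * ‖w‖) := mul_le_mul_of_nonneg_left (Pr.le_opNorm w) hC
    _ = C * ‖Pr‖ * ‖w‖ := by ring

omit [NormedSpace ℝ E] [CompleteSpace E] in
/-- Continuity at `0⁺` (within `[0, δ]`) of a function with `g 0 = 0` and a linear bound `‖g y‖ ≤ A y` on `[0, δ]`. [folklore] -/
theorem continuousWithinAt_zero_of_norm_le_mul {g : ℝ → E} {A δ : ℝ} (h0 : g 0 = 0)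
    (hb : ∀ y ∈ Icc 0 δ, ‖g y‖ ≤ A * y) : ContinuousWithinAt g (Icc 0 δ) 0 := by
  rw [Metric.continuousWithinAt_iff]
  intro ε hε
  refine ⟨ε / (|A| + 1), by positivity, fun y hyI hyd => ?_⟩
  rw [dist_eq_norm, Real.norm_eq_abs, sub_zero, abs_of_nonneg hyI.1] at hyd
  rw [h0, dist_zero_right]
  calc ‖g y‖ ≤ A * y := hb y hyI
    _ ≤ (|A| + 1) * y := by nlinarith [hyI.1, le_abs_self A]
    _ < (|A| + 1) * (ε / (|A| + 1)) := mul_lt_mul_of_pos_left hyd (by positivity)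
    _ = ε := by field_simp

omit [NormedSpace ℝ E] [CompleteSpace E] in
/-- The set of bounded continuous functions `ℝ →ᵇ E` with values in the closed ball `B̄(ξ, R)` is closed (hence complete).
[folklore] -/
theorem isClosed_setOf_forall_norm_sub_le (ξ : E) (R : ℝ) :
    IsClosed {f : ℝ →ᵇ E | ∀ s, ‖f s - ξ‖ ≤ R} := by
  have e : {f : ℝ →ᵇ E | ∀ s, ‖f s - ξ‖ ≤ R} = ⋂ s : ℝ, (fun f : ℝ →ᵇ E => f s) ⁻¹' closedBall ξ R := by
    ext f
    simp only [mem_setOf_eq, mem_iInter, mem_preimage, mem_closedBall, dist_eq_norm]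
  rw [e]
  exact isClosed_iInter fun s => isClosed_closedBall.preimage (continuous_eval_const s)

end Summit.NavierStokesRegularity.NavierStokesRegularity.Theorems.SkeletonJ1RUnstableCurve

end
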